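import Literature.AlgebraicGeometry.Frobenioids.ArchimedeanBasicProperties
import Literature.AlgebraicGeometry.Frobenioids.ArchimedeanBaseComparison
import Literature.AlgebraicGeometry.Frobenioids.SlimnessCounterexample
import Mathlib.CategoryTheory.PEmpty
import Mathlib.CategoryTheory.Functor.Const
import Mathlib.CategoryTheory.Discrete.Basic
import Mathlib.CategoryTheory.Limits.Shapes.Equalizers
import Mathlib.Data.Fin.VecNotation
import HarnessLib

/-!
# Frobenioids II, Theorem 3.6 (i), (ii), (vi), (viii), (ix), (x): the schemata `Thm36i_istrTypes F`,
# `Thm36ii_istrBaseTrivial F`, `Thm36vi D' X'`, `Thm36viii G F Λ`, `Thm36ix G F Λ`, `Thm36x Λ D' X'`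
# (FACT-LIST F-0692, F-0782, F-0696, F-1300, F-0788, F-0697) have REFUTABLE universal closures — they are
# facts AT THE NAMED INSTANCES only (part D)

Mochizuki, *The geometry of Frobenioids II: poly-Frobenioids*, Kyushu J. Math. **62** (2008) 401–460,
§3, Theorem 3.6 (i) p. 36 ("`(C^Λ)^istr` is of isotropic, base-trivial … type"), (ii) p. 37 ("`A^istr` is
of base-trivial … type"), (vi) p. 37 ("If `D` admits a pseudo-terminal object, then `F` admits a
pseudo-terminal object"), (viii) p. 38 ("If `Λ = ℤ`, then `F[ℂ]` is of weakly dissectible type"), (ix)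
p. 38 ("Suppose that `D` is of strongly indissectible type … Then `F^istr` is of strongly indissectible
type"), (x) p. 38 ("If `D` is slim, and `Λ ∈ {ℤ, ℝ}`, then `F` is also slim")
[cite: MochizukiFrdII2008, Thm 3.6 pp.36-38].

Negative knowledge recorded next to `ArchimedeanBasicProperties.lean` (abc-iut-L1-t9), PROOF-ONLY (no
definition, no instance), abc-iut cell seat abc-iut-f-008 (block F, float on the bindable «model-witness»
rows of the trunk file; class `preparatory`, kernel_closedness `parametrised`).  Parts A / B / C:
`ArchimedeanBasicPropertiesSchemaNegative.lean` (seat f-007), `…SchemaNegativeB.lean`, `…SchemaNegativeC.lean`.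

Each row is a PARAMETRISED predicate whose SUBJECT — the structure functor `F : X → F_Φ` with its base
`D`, resp. the bare categories `D'`, `X'` for (vi)/(x), resp. the comparison functor `G` and label `Λ` —
is a free binder ("Schema label … NO OTHER binding is a statement of the paper").  So the universal
closures say e.g. "EVERY pre-Frobenioid structure on every category has base-trivial isotropic part" or
"for ANY two categories, a pseudo-terminal object of the first yields one of the second", and are false.
This file supplies the minimal kernel objects, all over the one-object base `𝟙 = Discrete PUnit` with the
trivial divisor monoid `Φ_𝟙` ([FrdI] Def. 1.1 (iii), as in part A) unless a bare category suffices: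

* F-0692 / F-0782 (`istrTypes`, `istrBaseTrivial`): the CONSTANT structure functor on the two-object
  discrete category `Discrete Bool` — both objects are isotropic and base-isomorphic, but not isomorphic;
* F-0696 (vi): `D' := 𝟙` has a pseudo-terminal object, `X' := ∅` has none;
* F-1300 (viii): the constant structure functor on `𝟙` with the constant comparison functor "everything
  is complex" — the unique object is initial, so no weakly dissecting pair (whose sources must be
  NON-initial, [FrdII] §0) exists;
* F-0788 (ix): over the (strongly indissectible) base `𝟙`, the structure functor
  `parallelPair φ φ : (0 ⇉ 1) → F_{Φ_𝟙}` with `φ` the degree-`2` Frobenius endomorphism of the unique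
  object (so that the two parallel arrows are NOT pre-steps and both objects are isotropic): the pair
  `(left, right)` weakly dissects `1`, so `F^istr` is not of strongly indissectible type (`Λ := ℚ`
  discharges the complexifiability proviso);
* F-0697 (x): `D' := ∅` is slim (vacuously), `Λ := ℤ`, and `X' := F_{Φ_ℚ}` — the one-object elementary
  Frobenioid of the perfect monoid `(ℚ, +)` with its nontrivial unit `1` — is NOT slim ([FrdI]
  Rmk. 1.13.1, `ElemFrobenioid.not_isSlim_of_isPerfect`, `SlimnessCounterexample.lean`).

Theorems: `not_forall_thm36i_istrTypes`, `not_forall_thm36ii_istrBaseTrivial`, `not_forall_thm36vi`,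
`not_forall_thm36viii`, `not_forall_thm36ix`, `not_forall_thm36x` (¬ of the fully quantified closures,
universe level `0`), each from a named ¬-instance.

The INSTANCE forms — the only statements of the paper — are PROVED in the tree and are what consumers
bind: F-0692 ⟶ `ArchFrd.thm36i_istrTypes_C'` (`ArchimedeanIstrProofs.lean`), `ArchFrd.thm36i_istrTypes_A`,
`ArchFrd.Thm36Sub.thm36i_istrTypes_C_holds` (F-0870 at THE data); F-0782 ⟶ `ArchFrd.thm36ii_istrBaseTrivial_A`
(F-0873 ✓); F-0696 ⟶ `ArchFrd.thm36vi_C`, `thm36vi_A` (`ArchimedeanPseudoTerminal.lean`),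
`Thm36Sub.thm36vi_CA_holds` (F-0882); F-1300 ⟶ `ArchFrd.thm36viii_C`, `ArchFrd.thm36viii_CA_holds` (F-0885 ✓);
F-0788 ⟶ `ArchFrd.Indissect.thm36ix_C` (`ArchimedeanIndissectible.lean`), `Thm36Sub.ix_Q_holds` / `ix_R_holds`
(F-0879 at THE data); F-0697 ⟶ `ArchFrd.Slim.thm36x_C` (`ArchimedeanSlim.lean`), `ArchFrd.thm36x_A`,
`Thm36Sub.x_Q_holds` (F-0886 at THE data).  So each row is admissible ONLY in its instance form (FACT-LIST
class «universal-closure REFUTED; instance form PROVED»).  Elementary category theory; nothing here bears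
on the disputed [IUTchIII] Cor. 3.12 or takes a side; refuted-as-schema is a statement about OUR typing,
not about the paper.
-/

namespace Literature.AlgebraicGeometry.Frobenioids

namespace ArchFrd

open CategoryTheory CategoryTheory.Limits

/-! ### Auxiliary facts about the witnesses -/

namespace SchemaNegD

/-- Every object of the two-object discrete category is isotropic for the CONSTANT structure functor
(its only outgoing arrows are identities). [cite: MochizukiFrdI2008, Def. 1.2 (iv) p.23] -/
theorem isIsotropic_const_bool (A : Discrete Bool) :
    PreFrobenioid.IsIsotropic
      ((Functor.const (Discrete Bool)).obj
        (ElemFrobenioid.of (constMonoidOn PUnit.{1}) (Discrete.mk PUnit.unit))) A := by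
  intro B ψ _ _
  obtain ⟨a⟩ := A
  obtain ⟨b⟩ := B
  have h := Discrete.eq_of_hom ψ
  dsimp only at h
  subst h
  rw [Subsingleton.elim ψ (𝟙 _)]
  infer_instance

/-- Every object of the walking parallel pair `0 ⇉ 1` is isotropic for the structure functor
`parallelPair φ φ` with `φ` of Frobenius degree `2` (the two parallel arrows are not linear, hence not
pre-steps; the other arrows are identities). [cite: MochizukiFrdI2008, Def. 1.2 (iv) p.23] -/
theorem isIsotropic_parallelPair (A : WalkingParallelPair) :
    PreFrobenioid.IsIsotropic
      (parallelPair
        (ElemFrobenioid.homMk (A := ElemFrobenioid.of (constMonoidOn PUnit.{1}) (Discrete.mk PUnit.unit))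
          (B := ElemFrobenioid.of (constMonoidOn PUnit.{1}) (Discrete.mk PUnit.unit)) (𝟙 _) 1 2)
        (ElemFrobenioid.homMk (A := ElemFrobenioid.of (constMonoidOn PUnit.{1}) (Discrete.mk PUnit.unit))
          (B := ElemFrobenioid.of (constMonoidOn PUnit.{1}) (Discrete.mk PUnit.unit)) (𝟙 _) 1 2)) A := by
  intro B ψ _ hpre
  obtain ⟨hlin, -⟩ := hpre
  cases ψ with
  | left => change (2 : ℕ+) = 1 at hlin; exact absurd hlin (by decide)
  | right => change (2 : ℕ+) = 1 at hlin; exact absurd hlin (by decide)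
  | id _ => exact (inferInstance : IsIso (𝟙 A))

/-- The two parallel arrows of `0 ⇉ 1` are distinct. [cite: MochizukiFrdII2008, §0 p.5] -/
theorem left_ne_right : WalkingParallelPairHom.left ≠ WalkingParallelPairHom.right := by decide

/-- `(ℚ, +)` (written multiplicatively) is a perfect monoid: multiplication by `n ≥ 1` is bijective.
[cite: MochizukiFrdI2008, §0 p.11] -/
theorem isPerfect_multiplicative_rat : IsPerfect (Multiplicative ℚ) := by
  refine ⟨fun n hn => ?_⟩
  have hn' : (n : ℚ) ≠ 0 := Nat.cast_ne_zero.mpr hn.ne'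
  constructor
  · intro x y hxy
    have h : n • Multiplicative.toAdd x = n • Multiplicative.toAdd y := by
      rw [← toAdd_pow, ← toAdd_pow]; exact congrArg _ hxy
    rw [nsmul_eq_mul, nsmul_eq_mul] at h
    exact Multiplicative.toAdd.injective (mul_left_cancel₀ hn' h)
  · intro y
    refine ⟨Multiplicative.ofAdd (Multiplicative.toAdd y / n), ?_⟩
    dsimp only
    rw [← ofAdd_nsmul, nsmul_eq_mul, mul_div_cancel₀ _ hn', ofAdd_toAdd]

end SchemaNegD

open SchemaNegD

/-! ### F-0692: `Thm36i_istrTypes` and F-0782: `Thm36ii_istrBaseTrivial` -/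

/-- **F-0782, universal closure false:** for the CONSTANT structure functor on `Discrete Bool` (both
objects isotropic, over the same base object), `F^istr` is NOT of base-trivial type: `false` and `true`
are base-isomorphic but not isomorphic. [cite: MochizukiFrdII2008, Thm 3.6 (ii) p.37] -/
theorem not_thm36ii_istrBaseTrivial_const_bool :
    ¬ Thm36ii_istrBaseTrivial ((Functor.const (Discrete Bool)).obj
        (ElemFrobenioid.of (constMonoidOn PUnit.{1}) (Discrete.mk PUnit.unit))) := by
  intro h
  obtain ⟨e⟩ := h ⟨Discrete.mk true, isIsotropic_const_bool _⟩
    ⟨Discrete.mk false, isIsotropic_const_bool _⟩ ⟨Iso.refl _⟩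
  exact Bool.noConfusion (Discrete.eq_of_hom e.hom.hom)

/-- **F-0692, universal closure false:** the same structure functor refutes the second clause
("base-trivial type") of `Thm36i_istrTypes`. [cite: MochizukiFrdII2008, Thm 3.6 (i) p.36] -/
theorem not_thm36i_istrTypes_const_bool :
    ¬ Thm36i_istrTypes ((Functor.const (Discrete Bool)).obj
        (ElemFrobenioid.of (constMonoidOn PUnit.{1}) (Discrete.mk PUnit.unit))) :=
  fun h => not_thm36ii_istrBaseTrivial_const_bool h.2

/-- **F-0692 as a schema is not a fact:** the fully quantified closure of `ArchFrd.Thm36i_istrTypes` (over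
all structure functors, at universe level `0`) is FALSE; the printed clause is
`ArchFrd.thm36i_istrTypes_C'` / `thm36i_istrTypes_A` / `Thm36Sub.thm36i_istrTypes_C_holds`.
[cite: MochizukiFrdII2008, Thm 3.6 (i) p.36] -/
theorem not_forall_thm36i_istrTypes :
    ¬ ∀ {D : Type} [Category.{0} D] {Φ : Dᵒᵖ ⥤ CommMonCat.{0}} {X : Type} [Category.{0} X]
        (F : X ⥤ ElemFrobenioid Φ), Thm36i_istrTypes F :=
  fun h => not_thm36i_istrTypes_const_bool (h _)

/-- **F-0782 as a schema is not a fact:** the fully quantified closure of `ArchFrd.Thm36ii_istrBaseTrivial`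
(at universe level `0`) is FALSE; the printed clause is `ArchFrd.thm36ii_istrBaseTrivial_A` (F-0873).
[cite: MochizukiFrdII2008, Thm 3.6 (ii) p.37] -/
theorem not_forall_thm36ii_istrBaseTrivial :
    ¬ ∀ {D : Type} [Category.{0} D] {Φ : Dᵒᵖ ⥤ CommMonCat.{0}} {X : Type} [Category.{0} X]
        (F : X ⥤ ElemFrobenioid Φ), Thm36ii_istrBaseTrivial F :=
  fun h => not_thm36ii_istrBaseTrivial_const_bool (h _)

/-! ### F-0696: `Thm36vi` -/

/-- **F-0696, universal closure false:** `Thm36vi D' X'` relates two ARBITRARY categories; with `D' := 𝟙`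
(its object is pseudo-terminal) and `X' := ∅` (no object at all) it fails.
[cite: MochizukiFrdII2008, Thm 3.6 (vi) p.37] -/
theorem not_thm36vi_punit_pempty : ¬ Thm36vi (Discrete PUnit.{1}) (Discrete PEmpty.{1}) := by
  intro h
  obtain ⟨A, -⟩ := h ⟨Discrete.mk PUnit.unit, fun B => ⟨eqToHom (Subsingleton.elim _ _)⟩⟩
  exact A.as.elim

/-- **F-0696 as a schema is not a fact:** the fully quantified closure of `ArchFrd.Thm36vi` (over all pairs
of categories, at universe level `0`) is FALSE; the printed clause for `F ∈ {C^Λ, A}` over its own base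
`D` is `ArchFrd.thm36vi_C` / `thm36vi_A` / `Thm36Sub.thm36vi_CA_holds`.
[cite: MochizukiFrdII2008, Thm 3.6 (vi) p.37] -/
theorem not_forall_thm36vi :
    ¬ ∀ (D' : Type) [Category.{0} D'] (X' : Type) [Category.{0} X'], Thm36vi D' X' :=
  fun h => not_thm36vi_punit_pempty (h _ _)

/-! ### F-1300: `Thm36viii` -/

/-- **F-1300, universal closure false:** for the constant structure functor on `𝟙` and the constant
comparison functor with value `Spec ℂ`, `F[ℂ]` is the one-object category `𝟙`, whose object is initial
and hence admits no weakly dissecting pair (sources of a dissecting family are non-initial, [FrdII] §0);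
so `F[ℂ]` is not of weakly dissectible type although `Λ = ℤ`. [cite: MochizukiFrdII2008, Thm 3.6 (viii) p.38] -/
theorem not_thm36viii_const_punit :
    ¬ Thm36viii ((Functor.const (Discrete PUnit.{1})).obj (D0.toArchBase.obj D0.complex))
        ((Functor.const (Discrete PUnit.{1})).obj
          (ElemFrobenioid.of (constMonoidOn PUnit.{1}) (Discrete.mk PUnit.unit))) MonoidType.Z := by
  intro h
  obtain ⟨Xf, φ, hne, -⟩ := (h rfl).isWeaklyDissectible
    ⟨Discrete.mk PUnit.unit, (D0.isComplex_toArchBase_iff D0.complex).mpr rfl⟩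
  refine (hne 0).false (IsInitial.ofUniqueHom
    (fun Y => ObjectProperty.homMk (eqToHom (Subsingleton.elim _ _))) fun Y m => ?_)
  exact ObjectProperty.hom_ext _ (Subsingleton.elim _ _)

/-- **F-1300 as a schema is not a fact:** the fully quantified closure of `ArchFrd.Thm36viii` (at universe
level `0`) is FALSE; the printed clause is `ArchFrd.thm36viii_C` / `ArchFrd.thm36viii_CA_holds` (F-0885).
[cite: MochizukiFrdII2008, Thm 3.6 (viii) p.38] -/
theorem not_forall_thm36viii :
    ¬ ∀ {D : Type} [Category.{0} D] (G : D ⥤ ArchBase) {Φ : Dᵒᵖ ⥤ CommMonCat.{0}} {X : Type}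
        [Category.{0} X] (F : X ⥤ ElemFrobenioid Φ) (Λ : MonoidType), Thm36viii G F Λ :=
  fun h => not_thm36viii_const_punit (h _ _ _)

/-! ### F-0788: `Thm36ix` -/

/-- **F-0788, universal closure false:** over the strongly indissectible base `𝟙` (label `Λ := ℚ`, any
comparison functor), the structure functor `parallelPair φ φ : (0 ⇉ 1) → F_{Φ_𝟙}` with `deg_Fr(φ) = 2`
has `F^istr = F` (both objects isotropic), and the pair `(left, right)` of arrows `0 → 1` from the
non-initial object `0` weakly dissects `1`: so `F^istr` is NOT of strongly indissectible type.
[cite: MochizukiFrdII2008, Thm 3.6 (ix) p.38] -/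
theorem not_thm36ix_parallelPair :
    ¬ Thm36ix ((Functor.const (Discrete PUnit.{1})).obj (D0.toArchBase.obj D0.real))
        (parallelPair
          (ElemFrobenioid.homMk (A := ElemFrobenioid.of (constMonoidOn PUnit.{1}) (Discrete.mk PUnit.unit))
            (B := ElemFrobenioid.of (constMonoidOn PUnit.{1}) (Discrete.mk PUnit.unit)) (𝟙 _) 1 2)
          (ElemFrobenioid.homMk (A := ElemFrobenioid.of (constMonoidOn PUnit.{1}) (Discrete.mk PUnit.unit))
            (B := ElemFrobenioid.of (constMonoidOn PUnit.{1}) (Discrete.mk PUnit.unit)) (𝟙 _) 1 2))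
        MonoidType.Q := by
  intro h
  have h1 : IsOfStronglyIndissectibleType (Discrete PUnit.{1}) := ⟨fun A hW => by
    obtain ⟨Xf, ψ, hne, -⟩ := hW
    exact (hne 0).false (IsInitial.ofUniqueHom (fun Y => eqToHom (Subsingleton.elim _ _))
      fun Y m => Subsingleton.elim _ _)⟩
  have h3 := (h h1 fun _ hq => MonoidType.noConfusion hq).isStronglyIndissectible
    ⟨WalkingParallelPair.one, isIsotropic_parallelPair _⟩
  apply h3
  refine ⟨fun _ => ⟨WalkingParallelPair.zero, isIsotropic_parallelPair _⟩,
    ![ObjectProperty.homMk WalkingParallelPairHom.left, ObjectProperty.homMk WalkingParallelPairHom.right],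
    fun _ => ⟨fun hI => ?_⟩, ?_⟩
  · -- `0` is not initial: it has the two distinct arrows `left ≠ right` to `1`
    exact left_ne_right (congrArg InducedCategory.Hom.hom
      (hI.hom_ext (ObjectProperty.homMk WalkingParallelPairHom.left :
          (⟨WalkingParallelPair.zero, isIsotropic_parallelPair _⟩ :
              (PreFrobenioid.isotropicObjects _).FullSubcategory) ⟶
            ⟨WalkingParallelPair.one, isIsotropic_parallelPair _⟩)
        (ObjectProperty.homMk WalkingParallelPairHom.right)))
  · intro i j hij B _ ψi ψj heq
    have hh := congrArg InducedCategory.Hom.hom heq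
    obtain ⟨Bo, hBo⟩ := B
    obtain ⟨ψi⟩ := ψi
    obtain ⟨ψj⟩ := ψj
    cases ψi with
    | id _ =>
      cases ψj with
      | id _ =>
        fin_cases i <;> fin_cases j
        · exact hij rfl
        · exact left_ne_right hh
        · exact left_ne_right hh.symm
        · exact hij rfl

/-- **F-0788 as a schema is not a fact:** the fully quantified closure of `ArchFrd.Thm36ix` (at universe
level `0`) is FALSE; the printed clause is `ArchFrd.Indissect.thm36ix_C` / `Thm36Sub.ix_Q_holds` /
`ix_R_holds` (F-0879 at THE data). [cite: MochizukiFrdII2008, Thm 3.6 (ix) p.38] -/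
theorem not_forall_thm36ix :
    ¬ ∀ {D : Type} [Category.{0} D] (G : D ⥤ ArchBase) {Φ : Dᵒᵖ ⥤ CommMonCat.{0}} {X : Type}
        [Category.{0} X] (F : X ⥤ ElemFrobenioid Φ) (Λ : MonoidType), Thm36ix G F Λ :=
  fun h => not_thm36ix_parallelPair (h _ _ _)

/-! ### F-0697: `Thm36x` -/

/-- **F-0697, universal closure false:** `Thm36x Λ D' X'` relates two ARBITRARY categories; with `Λ := ℤ`,
`D' := ∅` (slim, vacuously) and `X' := F_{Φ_ℚ}`, the one-object elementary Frobenioid of the perfect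
monoid `(ℚ, +)` with its nontrivial unit `1`, which is NOT slim ([FrdI] Rmk. 1.13.1,
`ElemFrobenioid.not_isSlim_of_isPerfect`), it fails. [cite: MochizukiFrdII2008, Thm 3.6 (x) p.38] -/
theorem not_thm36x_pempty_rat :
    ¬ Thm36x MonoidType.Z (Discrete PEmpty.{1}) (ElemFrobenioid (constMonoidOn (Multiplicative ℚ))) := by
  intro h
  refine ElemFrobenioid.not_isSlim_of_isPerfect isPerfect_multiplicative_rat
    (toUnits (Multiplicative.ofAdd (1 : ℚ))) ?_ (h ⟨fun A => A.as.elim⟩ fun hq => MonoidType.noConfusion hq)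
  rw [Ne, EmbeddingLike.map_eq_one_iff, ofAdd_eq_one]
  exact one_ne_zero

/-- **F-0697 as a schema is not a fact:** the fully quantified closure of `ArchFrd.Thm36x` (over all labels
and all pairs of categories, at universe level `0`) is FALSE; the printed clause for `F ∈ {C^Λ, A}` over
its own slim base is `ArchFrd.Slim.thm36x_C` / `ArchFrd.thm36x_A` / `Thm36Sub.x_Q_holds` (F-0886 at THE
data). [cite: MochizukiFrdII2008, Thm 3.6 (x) p.38] -/
theorem not_forall_thm36x :
    ¬ ∀ (Λ : MonoidType) (D' : Type) [Category.{0} D'] (X' : Type) [Category.{0} X'], Thm36x Λ D' X' :=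
  fun h => not_thm36x_pempty_rat (h _ _ _)

end ArchFrd

end Literature.AlgebraicGeometry.Frobenioids
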